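import Summits.AnomalousDissipation.AnomalousDissipation.Theorems.SolenoidalFractalHomogenisationLagrangianStepZ7GlueDefs
import Summits.AnomalousDissipation.AnomalousDissipation.Theorems.SolenoidalFractalHomogenisationLagrangianStepFrameModulation
import Summits.AnomalousDissipation.AnomalousDissipation.Theorems.SolenoidalFractalHomogenisationLagrangianStepFrameMeasure
import HarnessLib

/-!
# L13 — the α-PROVIDER of `stub_Z7_alphaBeta`: FRAME CONJUGATION of the Eulerian window maps (typed targets; lead-k1l-onelevel-p1 g5, 2026-08-29)

Cruxes WORKFILE (sorries = the targets).  Memo `Lines/onelevel-L13-frame-conjugation.md`.  After the glue `Z7Glue.cellInputs_BIL_of` (p696796)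
the (BIL) clause of `stub_cellInputs` rests on `stub_Vmod_of_V` (certificate) and `stub_Z7_alphaBeta : Z7Glue.cellInputs_alphaBeta_text`, whose
α-part is, per refresh piece `[s,t]` (`s = j·R` a frame reset, `t ≤ s + R`), `Z7Glue.FrameConjugacyAt W M hM c Φ Cα ϱ E m S Um1 Um s t`.
THIS FILE types the objects and the four facts that produce it:

* §1 `frameRead E hR m s σ` — the unitary READING map `u ↦ u ∘ X m (s + σ/a(m+1)) s` of `V2 = L²(𝕋³;ℝ³)` at cell time `σ` (composition with the
  measure-preserving window flow, `Lp.compMeasurePreservingₗᵢ`), `frameReadInv` (composition with the inverse flow `X m s (s + σ/a)`), and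
  `conjProp E hR m s U σ₁ σ₂ := frameRead σ₂ ∘ U (s + σ₁/a) (s + σ₂/a) ∘ frameReadInv σ₁` — the CONJUGATE of an Eulerian two-parameter family;
* §2 (T1) `frameToEulerian_true` / `frameToEulerian_coarse` — FRAME ⇒ EULERIAN for weak solutions: a distorted weak solution in the frame (drift
  `cellField` / `0`, distortion `frameG`, cell time, base `σ₁`) read back through the inverse flow is an Eulerian `IsWeakTensorPassiveVectorOn` solution
  along `partialSum (m+1)` / `partialSum m` (physical time, tensor `× a(m+1)`) — the direction the `repr` field needs (uniqueness then comes from the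
  Eulerian propagator); the converse direction is NOT needed by the provider;
* §3 (T2)/(T3) `isDistortedPropagator_conjProp_true/_coarse` — the conjugates of the Eulerian propagators `Um1`, `Um` are `CellClauseMod.IsDistortedPropagator`s
  in the frame (fields: isometry + contraction; cocycle; `self_of_divFree`/`divFree`/`eq_zero_of_orth` through (L1) «`u` weakly div-free ⇔ `distort frameG (u∘X)`
  weakly div-free» (Piola); weak continuity (strong continuity of `σ ↦ frameRead σ z`); `repr` from (T1) + `IsPropagator.repr`);
* §4 (T4) `frameConjugacyAt_of_pieces` — ASSEMBLY: `IsModulation` of `frameG` (p3 g8 `isModulation_frameG_of`, p695470, inputs hnear/hrate p696381/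
  p696685, `hpiola` torus Piola bridge, `hcurv` = K8-5 with `θ := Cα'·strain m ≤ Cα·θ(m+1)`, `nC := ϱ·N m`) + (T2) + (T3) + the three identities
  (`ι = id` on the reset, `ι' = frameRead (a(t−s))`; losses equal because readings are isometries and `R₀ = id`) ⇒ `FrameConjugacyAt`.
Endpoint note: the glue's first piece is the CLOSED window `[jR, (j+1)R]`; all window inputs are continuous in `t`, so p3's strict `t − jR < R` in
`isModulation_frameG_of` must be relaxed to `≤` (closure) — the insertion identity is only used for a.e. time.
NOT proofs; nothing closed; AD not proved; rung F-D1.A0.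
-/

set_option linter.dupNamespace false

noncomputable section

namespace Summit.AnomalousDissipation.AnomalousDissipation.Cruxes.LagrangianRenormalisationStepDesign.OneLevelSplit.FrameConj

open Literature.Analysis Literature.Analysis.FluidPDE Literature.Analysis.FunctionSpaces
open MeasureTheory Set Filter UnitAddTorus
open scoped ENNReal NNReal InnerProductSpace
open Literature.Analysis.FluidPDE.LatticeShear (LagrangianLatticeCarrier LatticeWord)
open Summit.AnomalousDissipation.AnomalousDissipation.Theorems.SolenoidalFractalHomogenisation.LagrangianStep
open Summit.AnomalousDissipation.AnomalousDissipation.Theorems.SolenoidalFractalHomogenisation.LagrangianStep.CellClauseMod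
open Summit.AnomalousDissipation.AnomalousDissipation.Theorems.SolenoidalFractalHomogenisation.LagrangianStep.Z7Glue

variable {k : ℕ}

/-! ## §1 The reading maps and the conjugated family -/

/-- **The READING map of the frame started at `s`, at cell time `σ`**: `u ↦ u ∘ X m (s + σ/a(m+1)) s`, a linear isometry of `V2`
(the window flow preserves volume, `LevelRegular` (F2c)). -/
def frameRead (E : LagrangianLatticeCarrier k) (hR : E.LevelRegular) (m : ℕ) (s σ : ℝ) : V2 →L[ℝ] V2 :=
  (Lp.compMeasurePreservingₗᵢ ℝ (E.X m (s + σ / E.a (m + 1)) s) (hR.measurePreserving_X m (s + σ / E.a (m + 1)) s)).toContinuousLinearMap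

/-- **The inverse reading** at cell time `σ`: `v ↦ v ∘ X m s (s + σ/a(m+1))` (the flow maps invert each other, `X_X_symm`). -/
def frameReadInv (E : LagrangianLatticeCarrier k) (hR : E.LevelRegular) (m : ℕ) (s σ : ℝ) : V2 →L[ℝ] V2 :=
  (Lp.compMeasurePreservingₗᵢ ℝ (E.X m s (s + σ / E.a (m + 1))) (hR.measurePreserving_X m s (s + σ / E.a (m + 1)))).toContinuousLinearMap

/-- **The CONJUGATE of an Eulerian two-parameter family** `U` (physical time) by the frame started at `s`, in cell time:
`conjProp σ₁ σ₂ = frameRead σ₂ ∘ U (s + σ₁/a) (s + σ₂/a) ∘ frameReadInv σ₁`. -/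
def conjProp (E : LagrangianLatticeCarrier k) (hR : E.LevelRegular) (m : ℕ) (s : ℝ) (U : ℝ → ℝ → (V2 →L[ℝ] V2)) :
    ℝ → ℝ → (V2 →L[ℝ] V2) :=
  fun σ₁ σ₂ => (frameRead E hR m s σ₂).comp ((U (s + σ₁ / E.a (m + 1)) (s + σ₂ / E.a (m + 1))).comp (frameReadInv E hR m s σ₁))

/-! ## §2 (T1) FRAME ⇒ EULERIAN for weak solutions (the direction `repr` needs) -/

/-- **(T1-true)** A distorted weak solution of the TRUE member in the frame of window `j` (level `m+1`; drift `cellField`, distortion `frameG`,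
cell tensor `(1/n²)(ν•S)`, cell time, base `σ₁`) read back through the inverse flow is an Eulerian weak solution along `partialSum (m+1)` with
tensor `kbar (m+1) • S` from the read-back datum.  Ingredients: `IsInserted` (`b (m+1) ∘ X = DX·level`), `level_eq_cellField` + (W1) periodicity
(`cellField (τ + a·s) = cellField τ`), the chain rule for the tests (`LagrangianLatticeCarrierFrameChainRule`, `SobolevChangeOfVariablesMeasurePreserving`),
Piola for the test constraint, `integral_comp_X`, `Visc4.conj`/`viscAdjVar` = the pulled-back adjoint viscous operator, time rescaling `τ = a(t'−s)`. -/
theorem frameToEulerian_true (E : LagrangianLatticeCarrier k) (hL : E.LPermissible) (hReg : E.Regular) {W : LatticeWord k} {M : ℝ} {hM : 0 < M}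
    (hdes : E.design = W.stretch M hM) (m : ℕ) (j : ℕ) {t : ℝ}
    (hst : (j : ℝ) * E.refresh (m + 1) < t) (htR : t ≤ (j : ℝ) * E.refresh (m + 1) + E.refresh (m + 1))
    (S : Torus.Visc4 (Fin 3)) (hν : 0 < E.cellVisc (m + 1)) {σ₁ : ℝ} (hσ₁ : 0 ≤ σ₁)
    (hσ₁T : σ₁ < E.a (m + 1) * (t - (j : ℝ) * E.refresh (m + 1)))
    {φ : VF} (hφ : MemLp φ 2 volume)
    (hφdiv : Torus.IsWeaklyDivFree (Torus.distort (frameG E m ((j : ℝ) * E.refresh (m + 1) + σ₁ / E.a (m + 1)) ((j : ℝ) * E.refresh (m + 1))) φ))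
    {w : ℝ → VF}
    (hw : Torus.IsWeakTensorPassiveVectorDistortedOn 0 (E.a (m + 1) * (t - (j : ℝ) * E.refresh (m + 1)) - σ₁)
      ((1 / (E.N (m + 1) : ℝ) ^ 2) • (E.cellVisc (m + 1) • S))
      (fun τ => cellField W M hM (E.cellVisc (m + 1)) hν (E.N (m + 1)) (σ₁ + τ))
      (fun τ y => frameG E m ((j : ℝ) * E.refresh (m + 1) + (σ₁ + τ) / E.a (m + 1)) ((j : ℝ) * E.refresh (m + 1)) y) φ w) :
    Torus.IsWeakTensorPassiveVectorOn 0 (t - (j : ℝ) * E.refresh (m + 1) - σ₁ / E.a (m + 1)) (E.kbar (m + 1) • S)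
      (fun τ' => E.partialSum (m + 1) ((j : ℝ) * E.refresh (m + 1) + σ₁ / E.a (m + 1) + τ'))
      (φ ∘ E.X m ((j : ℝ) * E.refresh (m + 1)) ((j : ℝ) * E.refresh (m + 1) + σ₁ / E.a (m + 1)))
      (fun τ' x => w (E.a (m + 1) * τ') (E.X m ((j : ℝ) * E.refresh (m + 1)) ((j : ℝ) * E.refresh (m + 1) + σ₁ / E.a (m + 1) + τ') x)) := by
  sorry

/-- **(T1-coarse)** The same for the COARSE member: no drift in the frame, cell tensor `(1/n²)(ν•S + (c/ν)Φν((1/ν)(ν•S)))`, read back ⇒ an Eulerian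
weak solution along `partialSum m` with tensor `kbar m • renormStep (Φ ν) (gain/ν²) S` (units check memo L12 §1: `kbar m/((1+g)a(m+1)) = ν/n²`). -/
theorem frameToEulerian_coarse (E : LagrangianLatticeCarrier k) (hL : E.LPermissible) (hReg : E.Regular) {W : LatticeWord k} {M : ℝ} {hM : 0 < M}
    (hdes : E.design = W.stretch M hM) (m : ℕ) (j : ℕ) {t : ℝ}
    (hst : (j : ℝ) * E.refresh (m + 1) < t) (htR : t ≤ (j : ℝ) * E.refresh (m + 1) + E.refresh (m + 1))
    (S : Torus.Visc4 (Fin 3)) (c : ℝ) (hgain : E.gain = c) (Φ : ℝ → Torus.Visc4 (Fin 3) → Torus.Visc4 (Fin 3)) {σ₁ : ℝ} (hσ₁ : 0 ≤ σ₁)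
    (hσ₁T : σ₁ < E.a (m + 1) * (t - (j : ℝ) * E.refresh (m + 1)))
    {φ : VF} (hφ : MemLp φ 2 volume)
    (hφdiv : Torus.IsWeaklyDivFree (Torus.distort (frameG E m ((j : ℝ) * E.refresh (m + 1) + σ₁ / E.a (m + 1)) ((j : ℝ) * E.refresh (m + 1))) φ))
    {w : ℝ → VF}
    (hw : Torus.IsWeakTensorPassiveVectorDistortedOn 0 (E.a (m + 1) * (t - (j : ℝ) * E.refresh (m + 1)) - σ₁)
      ((1 / (E.N (m + 1) : ℝ) ^ 2) • (E.cellVisc (m + 1) • S +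
        (c / E.cellVisc (m + 1)) • Φ (E.cellVisc (m + 1)) ((1 / E.cellVisc (m + 1)) • (E.cellVisc (m + 1) • S))))
      (fun _ _ => 0)
      (fun τ y => frameG E m ((j : ℝ) * E.refresh (m + 1) + (σ₁ + τ) / E.a (m + 1)) ((j : ℝ) * E.refresh (m + 1)) y) φ w) :
    Torus.IsWeakTensorPassiveVectorOn 0 (t - (j : ℝ) * E.refresh (m + 1) - σ₁ / E.a (m + 1))
      (E.kbar m • renormStep (Φ (E.cellVisc (m + 1))) (E.gain / E.cellVisc (m + 1) ^ 2) S)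
      (fun τ' => E.partialSum m ((j : ℝ) * E.refresh (m + 1) + σ₁ / E.a (m + 1) + τ'))
      (φ ∘ E.X m ((j : ℝ) * E.refresh (m + 1)) ((j : ℝ) * E.refresh (m + 1) + σ₁ / E.a (m + 1)))
      (fun τ' x => w (E.a (m + 1) * τ') (E.X m ((j : ℝ) * E.refresh (m + 1)) ((j : ℝ) * E.refresh (m + 1) + σ₁ / E.a (m + 1) + τ') x)) := by
  sorry

/-! ## §3 (L1) solenoidality through the frame; (T2)/(T3) the conjugates are distorted propagators -/

/-- **(L1)** A field is weakly divergence free iff its frame reading, distorted by `frameG`, is (Piola: the columns of `frameG` are divergence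
free; chain rule; change of variables under the measure-preserving flow). -/
theorem isWeaklyDivFree_distort_frameRead_iff (E : LagrangianLatticeCarrier k) (hL : E.LPermissible) (hReg : E.Regular) (m : ℕ) (j : ℕ)
    {t' : ℝ} (hw : (j : ℝ) * E.refresh (m + 1) ≤ t') (ht' : t' ≤ (j : ℝ) * E.refresh (m + 1) + E.refresh (m + 1)) (u : V2) :
    Torus.IsWeaklyDivFree (Torus.distort (frameG E m t' ((j : ℝ) * E.refresh (m + 1)))
        (⇑(frameRead E hReg.1 m ((j : ℝ) * E.refresh (m + 1)) (E.a (m + 1) * (t' - (j : ℝ) * E.refresh (m + 1))) u) : VF)) ↔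
      Torus.IsWeaklyDivFree (⇑u : VF) := by
  sorry

/-- **(T2)** The conjugate of the TRUE propagator is a distorted propagator of the cell member in the frame. -/
theorem isDistortedPropagator_conjProp_true (E : LagrangianLatticeCarrier k) (hL : E.LPermissible) (hReg : E.Regular) {W : LatticeWord k} {M : ℝ}
    {hM : 0 < M} (hdes : E.design = W.stretch M hM) (m : ℕ) (j : ℕ) {t : ℝ}
    (hst : (j : ℝ) * E.refresh (m + 1) < t) (htR : t ≤ (j : ℝ) * E.refresh (m + 1) + E.refresh (m + 1)) (ht1 : t ≤ 1)
    (S : Torus.Visc4 (Fin 3)) (hν : 0 < E.cellVisc (m + 1)) {Um1 : ℝ → ℝ → (V2 →L[ℝ] V2)}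
    (hUm1 : Torus.IsPropagator 1 (E.partialSum (m + 1)) (E.kbar (m + 1) • S) Um1) :
    IsDistortedPropagator (E.a (m + 1) * (t - (j : ℝ) * E.refresh (m + 1))) ((1 / (E.N (m + 1) : ℝ) ^ 2) • (E.cellVisc (m + 1) • S))
      (cellField W M hM (E.cellVisc (m + 1)) hν (E.N (m + 1)))
      (fun τ y => frameG E m ((j : ℝ) * E.refresh (m + 1) + τ / E.a (m + 1)) ((j : ℝ) * E.refresh (m + 1)) y)
      (conjProp E hReg.1 m ((j : ℝ) * E.refresh (m + 1)) Um1) := by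
  sorry

/-- **(T3)** The conjugate of the COARSE propagator is a distorted propagator of the coarse member (no drift) in the frame. -/
theorem isDistortedPropagator_conjProp_coarse (E : LagrangianLatticeCarrier k) (hL : E.LPermissible) (hReg : E.Regular) {W : LatticeWord k} {M : ℝ}
    {hM : 0 < M} (hdes : E.design = W.stretch M hM) (m : ℕ) (j : ℕ) {t : ℝ}
    (hst : (j : ℝ) * E.refresh (m + 1) < t) (htR : t ≤ (j : ℝ) * E.refresh (m + 1) + E.refresh (m + 1)) (ht1 : t ≤ 1)
    (S : Torus.Visc4 (Fin 3)) (c : ℝ) (hgain : E.gain = c) (Φ : ℝ → Torus.Visc4 (Fin 3) → Torus.Visc4 (Fin 3))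
    {Um : ℝ → ℝ → (V2 →L[ℝ] V2)}
    (hUm : Torus.IsPropagator 1 (E.partialSum m) (E.kbar m • renormStep (Φ (E.cellVisc (m + 1))) (E.gain / E.cellVisc (m + 1) ^ 2) S) Um) :
    IsDistortedPropagator (E.a (m + 1) * (t - (j : ℝ) * E.refresh (m + 1)))
      ((1 / (E.N (m + 1) : ℝ) ^ 2) • (E.cellVisc (m + 1) • S +
        (c / E.cellVisc (m + 1)) • Φ (E.cellVisc (m + 1)) ((1 / E.cellVisc (m + 1)) • (E.cellVisc (m + 1) • S))))
      (fun _ _ => 0)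
      (fun τ y => frameG E m ((j : ℝ) * E.refresh (m + 1) + τ / E.a (m + 1)) ((j : ℝ) * E.refresh (m + 1)) y)
      (conjProp E hReg.1 m ((j : ℝ) * E.refresh (m + 1)) Um) := by
  sorry

/-! ## §4 (T4) ASSEMBLY of `FrameConjugacyAt` -/

/-- **(T4)** `FrameConjugacyAt` on a refresh piece from: a modulation datum for `frameG` with the decay links, (T2), (T3), and the reading
identities (`ι = id`, `ι' = frameRead (a(t−s))`).  The identities are operator algebra: `frameRead 0 = frameReadInv 0 = id` (`X s s = id`),
`frameRead σ ∘ frameReadInv σ = id`, readings are isometries, `⟪R v, R z⟫ = ⟪v, z⟫`, `(R U R₀⁻¹)† (R y) = U† y`. -/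
theorem frameConjugacyAt_of_pieces (E : LagrangianLatticeCarrier k) (hL : E.LPermissible) (hReg : E.Regular) {W : LatticeWord k} {M : ℝ}
    {hM : 0 < M} (hdes : E.design = W.stretch M hM) (m : ℕ) (j : ℕ) {t : ℝ}
    (hst : (j : ℝ) * E.refresh (m + 1) < t) (htR : t ≤ (j : ℝ) * E.refresh (m + 1) + E.refresh (m + 1)) (ht1 : t ≤ 1)
    (S : Torus.Visc4 (Fin 3)) (c : ℝ) (hgain : E.gain = c) (Φ : ℝ → Torus.Visc4 (Fin 3) → Torus.Visc4 (Fin 3)) {Cα ϱ θ : ℝ}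
    (hθ0 : 0 ≤ θ) (hθ : θ ≤ Cα * E.θ (m + 1)) (hϱ : 0 ≤ ϱ)
    (hmod : IsModulation θ (E.a (m + 1) * (t - (j : ℝ) * E.refresh (m + 1))) (ϱ * E.N m)
      (fun τ y => frameG E m ((j : ℝ) * E.refresh (m + 1) + τ / E.a (m + 1)) ((j : ℝ) * E.refresh (m + 1)) y))
    {Um Um1 : ℝ → ℝ → (V2 →L[ℝ] V2)}
    (hUm : Torus.IsPropagator 1 (E.partialSum m) (E.kbar m • renormStep (Φ (E.cellVisc (m + 1))) (E.gain / E.cellVisc (m + 1) ^ 2) S) Um)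
    (hUm1 : Torus.IsPropagator 1 (E.partialSum (m + 1)) (E.kbar (m + 1) • S) Um1) :
    FrameConjugacyAt W M hM c Φ Cα ϱ E m S Um1 Um ((j : ℝ) * E.refresh (m + 1)) t := by
  sorry

end Summit.AnomalousDissipation.AnomalousDissipation.Cruxes.LagrangianRenormalisationStepDesign.OneLevelSplit.FrameConj

end
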